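import Literature.AnabelianGeometry.SemiGraphs.TemperedAnabelianThm66Sub
import Literature.AnabelianGeometry.SemiGraphs.QuotientIsoSystemLift
import Literature.AnabelianGeometry.SemiGraphs.TemperedAnabelianThm64SubProofs
import Mathlib.Topology.Algebra.Group.Quotient
import HarnessLib

/-!
# [SemiAnbd] Theorem 6.6: proofs of the group-theoretic rows of the sub-DAG (L08, L09, assembly)

Mochizuki, *Semi-graphs of anabelioids*, Publ. RIMS **42** (2006) [SemiAnbd], §6, Theorem 6.6,
proof pp. 72–73 (author's manuscript). [cite: MochizukiSemiAnbd2006, Thm 6.6 pp.72-73]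

Proof-only companion (theorems, no definitions) of `TemperedAnabelianThm66Sub.lean` (abc-iut cell,
sub-DAG `plan/L3/SUBDAG-SemiAnbd-Thm66.md`):

* **L01** `temperedIsoCompletes_holds` — "it is immediate that every outer isomorphism
  `Π^temp_{X_K} ⥲ Π^temp_{Y_L}` determines an outer isomorphism `Π_{X_K} ⥲ Π_{Y_L}`" (p. 72): from the
  universal property of the profinite completion (`completionExtends_holds` both ways +
  `completion_unique`, sub-DAG of Thm 6.4, abc-iut-w5-d139);
* separation / closedness lemmas for a `SpecializationIsoSystem` (`⋂ H_X = 1`, `⋂ J_X = 1`,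
  `J_Y^∧ ⊆ H_Y`);
* **L08** `SpecializationIsoSystem.exists_liesUnder` — "by passing to the corresponding inverse limit …
  the various `β_H` determine an isomorphism `β : Π^temp_{X_K} ⥲ Π^temp_{Y_L}` whose profinite completion
  `β̂` differs from `α̂` by an inner automorphism" (p. 73), from the abstract theorem
  `QuotientIsoSystemLift.exists_continuousMulEquiv_liesUnder`;
* **L09** `liesUnder_unique_of_piTempNormallyTerminal` — "That such a `β` is unique, up to inner
  automorphism, follows from Lemma 6.1, (iii)" (p. 73);
* the ASSEMBLY `profiniteOuterIsoLifts_of_system` and its origin-guarded form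
  `TemperedOrigin.profiniteOuterIsoLiftsHolds_of`: the typed node `ProfiniteOuterIsoLifts X Y` follows
  from the existence of a specialisation isomorphism system for every `α̂` (rows L02–L07, FACT-policy)
  and Lemma 6.1 (iii).

Classical topological group theory over the interface axioms; nothing here concerns the disputed
parts of inter-universal Teichmüller theory or takes a side on [IUTchIII] Cor. 3.12.
-/

noncomputable section

namespace Literature.AnabelianGeometry.SemiGraphs

open _root_.Topology

namespace TemperedCurve

variable {p : ℕ} [Fact p.Prime]

namespace SpecializationIsoSystem

variable {X Y : TemperedCurve p} {αhat : X.PiHat ≃ₜ* Y.PiHat} (S : SpecializationIsoSystem X Y αhat)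

/-- `⋂_n H_X(n) = 1` in `Π_{X_K}` (cofinality + Hausdorffness of the profinite completion).
[cite: MochizukiSemiAnbd2006, Thm 6.6 proof p.72] -/
theorem eq_one_of_forall_mem_HX (x : X.PiHat) (hx : ∀ n, x ∈ S.HX n) : x = 1 := by
  haveI := X.isProfiniteCompletion_toHat.t2Space
  by_contra h
  obtain ⟨n, hn⟩ := S.cofinal_HX {x}ᶜ isOpen_compl_singleton (by simpa using (Ne.symm h))
  exact hn (hx n) rfl

/-- `⋂_n H_Y(n) = 1` in `Π_{Y_L}`. [cite: MochizukiSemiAnbd2006, Thm 6.6 proof p.72] -/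
theorem eq_one_of_forall_mem_HY (y : Y.PiHat) (hy : ∀ n, y ∈ S.HY n) : y = 1 := by
  have h : αhat.symm y = 1 := by
    refine S.eq_one_of_forall_mem_HX _ fun n => ?_
    have := hy n
    rw [S.HY_eq n] at this
    exact (Subgroup.mem_map_equiv).mp this
  simpa using congrArg αhat h

/-- SEPARATION `⋂ J_X = 1` (from `J_X ⊆ H_X`, `⋂ H_X = 1` and injectivity of `Π^temp_{X_K} ↪ Π_{X_K}`).
[cite: MochizukiSemiAnbd2006, Thm 6.6 proof p.72] -/
theorem eq_one_of_forall_mem_JX (t : X.PiTemp) (ht : ∀ n, t ∈ S.JX n) : t = 1 := by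
  apply X.toHat_injective
  rw [map_one]
  exact S.eq_one_of_forall_mem_HX _ fun n => (S.JX_le n (ht n)).1

/-- SEPARATION `⋂ J_Y = 1`. [cite: MochizukiSemiAnbd2006, Thm 6.6 proof p.72] -/
theorem eq_one_of_forall_mem_JY (t : Y.PiTemp) (ht : ∀ n, t ∈ S.JY n) : t = 1 := by
  apply Y.toHat_injective
  rw [map_one]
  exact S.eq_one_of_forall_mem_HY _ fun n => (S.JY_le n (ht n)).1

/-- `H_Y(n)` is open (image of the open `H_X(n)` under the homeomorphism `α̂`), hence closed.
[cite: MochizukiSemiAnbd2006, Thm 6.6 proof p.72] -/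
theorem isClosed_HY (n : ℕ) : IsClosed (S.HY n : Set Y.PiHat) := by
  refine Subgroup.isClosed_of_isOpen _ ?_
  rw [S.HY_eq n]
  exact αhat.toHomeomorph.isOpenMap _ (S.isOpen_HX n)

/-- `J_Y^∧ = closure of ι_Y(J_Y) ⊆ H_Y`. [cite: MochizukiSemiAnbd2006, Thm 6.6 proof p.72] -/
theorem closure_map_JY_le (n : ℕ) :
    ((S.JY n).map Y.toHat.toMonoidHom).topologicalClosure ≤ S.HY n :=
  Subgroup.topologicalClosure_minimal _
    (Subgroup.map_le_iff_le_comap.mpr fun _ h => (S.JY_le n h).1) (S.isClosed_HY n)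

include S in
/-- **L08, PROVED** — "by passing to the corresponding inverse limit, we conclude that the various
`β_H` determine an isomorphism of tempered fundamental groups `β : Π^temp_{X_K} ⥲ Π^temp_{Y_L}` whose
profinite completion `β̂` differs from `α̂` by an inner automorphism" (p. 73): from the system data,
by the abstract theorem `QuotientIsoSystemLift.exists_continuousMulEquiv_liesUnder` (rectification
of the `β_H` by inner automorphisms, completeness, and compactness of `Π_{Y_L}`).
[cite: MochizukiSemiAnbd2006, Thm 6.6 proof p.73] -/
theorem exists_liesUnder : ∃ β : X.PiTemp ≃ₜ* Y.PiTemp, LiesUnder X Y αhat β := by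
  haveI := Y.isProfiniteCompletion_toHat.compactSpace
  have hanti : ∀ n, (S.HY (n + 1) : Set Y.PiHat) ⊆ S.HY n := fun n => by
    rw [S.HY_eq, S.HY_eq]
    exact Subgroup.map_mono (S.antitone_HX (Nat.le_succ n))
  have hunder : ∀ n, ∃ e : Y.PiHat, ∀ (g : X.PiTemp) (y : Y.PiTemp),
      S.β n (g : X.PiTemp ⧸ S.JX n) = (y : Y.PiTemp ⧸ S.JY n) →
        (e * Y.toHat.toMonoidHom y * e⁻¹)⁻¹ * αhat (X.toHat g) ∈ (S.HY n : Set Y.PiHat) :=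
    fun n => by
    obtain ⟨e, he⟩ := S.underHat n
    exact ⟨e, fun g y h => S.closure_map_JY_le n (he g y h)⟩
  obtain ⟨β, f, hf⟩ := QuotientIsoSystemLift.exists_continuousMulEquiv_liesUnder
    (hnX := S.normal_JX) (hnY := S.normal_JY) S.JX S.JY S.eq_one_of_forall_mem_JX S.eq_one_of_forall_mem_JY S.initial_JX S.initial_JY S.complete_JX
    S.complete_JY S.β S.compat Y.toHat.toMonoidHom (fun g => αhat (X.toHat g))
    (fun n => (S.HY n : Set Y.PiHat)) S.isClosed_HY hanti S.eq_one_of_forall_mem_HY hunder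
  exact ⟨β, f, hf⟩

end SpecializationIsoSystem

/-! ### L01: tempered isomorphisms complete to profinite isomorphisms -/

/-- **L01, PROVED** — "it is immediate that every outer isomorphism `Π^temp_{X_K} ⥲ Π^temp_{Y_L}`
determines an outer isomorphism `Π_{X_K} ⥲ Π_{Y_L}`" ([SemiAnbd] Thm 6.6 proof, p. 72, first
sentence): extend `ι_Y ∘ β` and `ι_X ∘ β⁻¹` along the completions (universal property,
`completionExtends_holds`) and note that the two extensions are mutually inverse by uniqueness
(`completion_unique`). [cite: MochizukiSemiAnbd2006, Thm 6.6 proof p.72] -/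
theorem temperedIsoCompletes_holds (X Y : TemperedCurve p) : TemperedIsoCompletes X Y := by
  intro β
  obtain ⟨Φ, hΦ⟩ := completionExtends_holds X Y ⟨β.toMulEquiv.toMonoidHom, β.continuous⟩
  obtain ⟨Ψ, hΨ⟩ := completionExtends_holds Y X ⟨β.symm.toMulEquiv.toMonoidHom, β.symm.continuous⟩
  have hΦ' : ∀ x : X.PiTemp, Φ (X.toHat x) = Y.toHat (β x) := hΦ
  have hΨ' : ∀ y : Y.PiTemp, Ψ (Y.toHat y) = X.toHat (β.symm y) := hΨ
  have h1 : Ψ.comp Φ = ContinuousMonoidHom.id X.PiHat :=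
    completion_unique X X _ _ fun x => by
      change Ψ (Φ (X.toHat x)) = X.toHat x
      rw [hΦ', hΨ', ContinuousMulEquiv.symm_apply_apply]
  have h2 : Φ.comp Ψ = ContinuousMonoidHom.id Y.PiHat :=
    completion_unique Y Y _ _ fun y => by
      change Φ (Ψ (Y.toHat y)) = Y.toHat y
      rw [hΨ', hΦ', ContinuousMulEquiv.apply_symm_apply]
  have hl : Function.LeftInverse Ψ Φ := fun x => by
    change (Ψ.comp Φ) x = x
    rw [h1]; rfl
  have hr : Function.RightInverse Ψ Φ := fun y => by
    change (Φ.comp Ψ) y = y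
    rw [h2]; rfl
  exact ⟨ContinuousMulEquiv.mk (MulEquiv.mk ⟨Φ, Ψ, hl, hr⟩ (map_mul Φ)) Φ.continuous Ψ.continuous,
    hΦ'⟩

/-! ### L09: uniqueness from Lemma 6.1 (iii) -/

/-- **L09, PROVED** — "That such a `β` is unique, up to inner automorphism, follows from Lemma 6.1,
(iii)" (p. 73): if `β`, `β′` both lie under `α̂`, then `c′⁻¹c` normalises `ι_Y(Π^temp_{Y_L})`, so lies
in it by `N_{Π_{Y_L}}(Π^temp_{Y_L}) = Π^temp_{Y_L}` (Lemma 6.1 (iii), the typed `PiTempNormallyTerminal`),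
and `β′ = Inn(y) ∘ β` by injectivity of `ι_Y`. [cite: MochizukiSemiAnbd2006, Thm 6.6 proof p.73] -/
theorem liesUnder_unique_of_piTempNormallyTerminal {X Y : TemperedCurve p}
    (h61 : Y.PiTempNormallyTerminal) (αhat : X.PiHat ≃ₜ* Y.PiHat) (β β' : X.PiTemp ≃ₜ* Y.PiTemp)
    (hβ : LiesUnder X Y αhat β) (hβ' : LiesUnder X Y αhat β') :
    ∃ y : Y.PiTemp, ∀ g : X.PiTemp, β' g = y * β g * y⁻¹ := by
  obtain ⟨c, hc⟩ := hβ
  obtain ⟨c', hc'⟩ := hβ'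
  set δ : Y.PiHat := c'⁻¹ * c with hδ
  have key : ∀ g : X.PiTemp, Y.toHat (β' g) = δ * Y.toHat (β g) * δ⁻¹ := fun g => by
    have h := (hc' g).symm.trans (hc g)
    -- h : c' * ι(β' g) * c'⁻¹ = c * ι(β g) * c⁻¹
    calc Y.toHat (β' g) = c'⁻¹ * (c' * Y.toHat (β' g) * c'⁻¹) * c' := by group
      _ = c'⁻¹ * (c * Y.toHat (β g) * c⁻¹) * c' := by rw [h]
      _ = δ * Y.toHat (β g) * δ⁻¹ := by rw [hδ]; group
  have hmem : δ ∈ Subgroup.normalizer (Y.toHat.toMonoidHom.range : Set Y.PiHat) := by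
    refine Subgroup.mem_set_normalizer_iff.mpr fun h => ⟨?_, ?_⟩
    · rintro ⟨t, rfl⟩
      refine ⟨β' (β.symm t), ?_⟩
      change Y.toHat (β' (β.symm t)) = δ * Y.toHat t * δ⁻¹
      rw [key, ContinuousMulEquiv.apply_symm_apply]
    · rintro ⟨t, ht⟩
      refine ⟨β (β'.symm t), ?_⟩
      change Y.toHat t = δ * h * δ⁻¹ at ht
      change Y.toHat (β (β'.symm t)) = h
      have h2 : Y.toHat t = δ * Y.toHat (β (β'.symm t)) * δ⁻¹ := by
        rw [← key, ContinuousMulEquiv.apply_symm_apply]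
      have h3 : δ * h * δ⁻¹ = δ * Y.toHat (β (β'.symm t)) * δ⁻¹ := ht.symm.trans h2
      exact (mul_left_cancel (mul_right_cancel h3)).symm
  have hδ' : δ ∈ Y.toHat.toMonoidHom.range := by
    have h := h61
    unfold PiTempNormallyTerminal at h
    rw [h] at hmem
    exact hmem
  obtain ⟨y, hy⟩ := hδ'
  refine ⟨y, fun g => Y.toHat_injective ?_⟩
  change Y.toHat y = δ at hy
  rw [key, map_mul, map_mul, map_inv, hy]

/-! ### Assembly -/

/-- **Assembly of [SemiAnbd] Theorem 6.6 from the sub-DAG** (pp. 72–73): the typed node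
`ProfiniteOuterIsoLifts X Y` follows from the EXISTENCE of a specialisation isomorphism system for
every `α̂` (rows L02–L07: [Mzk3] Lem. 2.3 + §3 + Ex. 5.6, FACT-policy) and Lemma 6.1 (iii) for `Y`
(`PiTempNormallyTerminal`); rows L08 and L09 are discharged in the kernel.  A conditional reduction,
not a proof of the theorem for arbitrary interface data. [cite: MochizukiSemiAnbd2006, Thm 6.6 pp.72-73] -/
theorem profiniteOuterIsoLifts_of_system {X Y : TemperedCurve p}
    (hS : ∀ αhat : X.PiHat ≃ₜ* Y.PiHat, Nonempty (SpecializationIsoSystem X Y αhat))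
    (h61 : Y.PiTempNormallyTerminal) : X.ProfiniteOuterIsoLifts Y := fun αhat => by
  obtain ⟨S⟩ := hS αhat
  exact ⟨S.exists_liesUnder,
    fun β β' hβ hβ' => liesUnder_unique_of_piTempNormallyTerminal h61 αhat β β' hβ hβ'⟩

end TemperedCurve

namespace TemperedOrigin

variable {p : ℕ} [Fact p.Prime]

/-- **[SemiAnbd] Theorem 6.6 as printed, reduced to its inputs**: the origin-guarded Thm 6.6
(`ProfiniteOuterIsoLiftsHolds`) follows from the origin-guarded specialisation-system statement
(rows L02–L07) and Lemma 6.1 (ii)(iii) as printed (`ProfiniteNormalizersHolds`); the inverse-limit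
step (L08) and the uniqueness step (L09) are kernel theorems.
[cite: MochizukiSemiAnbd2006, Thm 6.6 pp.72-73] -/
theorem profiniteOuterIsoLiftsHolds_of (Ω : TemperedOrigin p) (hS : Ω.SpecializationIsoSystemHolds)
    (h61 : Ω.ProfiniteNormalizersHolds) : Ω.ProfiniteOuterIsoLiftsHolds :=
  fun X Y hX hY =>
    TemperedCurve.profiniteOuterIsoLifts_of_system (hS X Y hX hY) (h61 Y hY).2

end TemperedOrigin

end Literature.AnabelianGeometry.SemiGraphs

end
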